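import Mathlib.Analysis.Normed.Operator.Bilinear
import Mathlib.Analysis.Calculus.ContDiff.Operations
import Mathlib.Topology.Algebra.Module.FiniteDimension
import Literature.Topology.Immersions.OpenParallelizableImmersionFrames
import HarnessLib

/-!
# Frame derivatives and coordinates in a continuous frame

Topic `Literature/Topology/Immersions` (infrastructure for the frame form of the immersion
theory of open manifolds, `OpenParallelizableImmersionFrames.lean`). Fix a family of vector
fields `σ = (σᵢ)ᵢ`, `i < n`, on an `n`-manifold `M`, linearly independent at each point — a
frame; when the `σᵢ` are continuous this is a topological trivialisation `TM ≅ M × ℝⁿ` (Hirsch,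
*Differential Topology*, Ch. 4 §2: a bundle is trivial iff it has `n` linearly independent
sections).

* `Literature.Topology.Immersions.frameDeriv σ f x` — the **frame derivative**
  `(d f_x (σᵢ x))ᵢ ∈ (ℝⁿ)ⁿ` of a map `f : M → ℝⁿ`: the matrix of `d f_x` in the basis `σ(x)`
  (Phillips' gradient `n`-frame `∇f`, §7 p. 195, read on `σ`);
  `continuousOn_frameDeriv_extChartAt`, `linearIndependent_frameDeriv_extChartAt`: the frame
  read in a chart `φ` (`frameDeriv σ φ`) is continuous on the chart domain and consists of
  linearly independent families.
* `Literature.Topology.Immersions.frameBasis`, `frameCoord σ x v` — the basis `σ(x)` of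
  `T_x M = ℝⁿ` and the **coordinates** of a tangent vector in it (`sum_frameCoord_smul`,
  `frameCoord_eq_of_sum_eq`, `frameCoord_frame`).
* `Literature.Topology.Immersions.continuous_frameCoord` — **frame coordinates are continuous
  on `TM`**: for every continuous family of tangent vectors `p ↦ w p ∈ T_{y p} M` (continuous
  into `TangentBundle`) the coordinates `p ↦ frameCoord σ (y p) (w p) ∈ ℝⁿ` are continuous.
  Read in the trivialisation of `TM` at `y p₀` — i.e. after applying `d φ`, `φ` the chart at
  `y p₀` — the frame becomes a continuous family of bases `S(z)` of the fixed space `ℝⁿ` and the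
  family a continuous `ℝⁿ`-valued map `W`, and the coordinates are `A(z)⁻¹ W` for the continuous
  family of isomorphisms `A(z) : u ↦ ∑ uₖ Sₖ(z)`, inversion being continuous at invertible maps
  (`contDiffAt_map_inverse`).
* `Literature.Topology.Immersions.continuous_frameCoord_smul_sum` — hence, for a continuous field
  `Ψ : M → (ℝⁿ)ⁿ`, the fibrewise linear bundle map `TM → ℝⁿ`, `σₖ x ↦ Ψ x k`, is continuous
  along continuous families of tangent vectors.

Everything is **proved**; the three `def`s are abbreviations with unfolding lemmas.

## References

* M. W. Hirsch, *Differential Topology*, GTM 33 (1976), Ch. 4 §2 (trivial bundles and frames).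
  [HirschDT1976]
* A. Phillips, *Submersions of open manifolds*, Topology **6** (1967), §7 p. 195 (the gradient
  frame `∇f`). [Phillips1967]
-/

open scoped Manifold ContDiff Topology
open Set Function Filter Bundle Module

noncomputable section

namespace Literature.Topology.Immersions

open Literature.Topology.FourManifolds (trivializationAt_tangentSpace_snd)

/-- Local notation: `𝔼 n` is the model Euclidean space `EuclideanSpace ℝ (Fin n)`. -/
local notation "𝔼 " n:arg => EuclideanSpace ℝ (Fin n)

variable {n : ℕ} {M : Type*} [TopologicalSpace M] [ChartedSpace (𝔼 n) M]

/-! ### The frame derivative -/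

/-- The **frame derivative** of `f : M → ℝⁿ` with respect to a family of vector fields
`σ = (σᵢ)ᵢ` on `M`: the family `(d f_x (σᵢ x))ᵢ` of vectors of `ℝⁿ` — the columns of the matrix
of `d f_x` in the basis `σ(x)` when `σ` is a frame. For `f = (f₁, …, fₙ)` this is the datum of
Phillips' gradient `n`-frame `∇f(x) = (∇f₁(x), …, ∇fₙ(x))` (§7, p. 195) read on `σ`.
[cite: Phillips1967, §7, p. 195] -/
def frameDeriv (σ : Fin n → M → 𝔼 n) (f : M → 𝔼 n) (x : M) : Fin n → 𝔼 n :=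
  fun i => mfderiv (𝓡 n) (𝓡 n) f x (σ i x)

/-- Unfolding lemma for `frameDeriv`. [cite: Phillips1967, §7, p. 195] -/
@[simp]
theorem frameDeriv_apply (σ : Fin n → M → 𝔼 n) (f : M → 𝔼 n) (x : M) (i : Fin n) :
    frameDeriv σ f x i = mfderiv (𝓡 n) (𝓡 n) f x (σ i x) :=
  rfl

/-- The frame derivative at `x` depends only on the germ of `f` at `x`. [folklore] -/
theorem frameDeriv_congr_of_eventuallyEq {σ : Fin n → M → 𝔼 n} {f g : M → 𝔼 n} {x : M}
    (h : f =ᶠ[𝓝 x] g) : frameDeriv σ f x = frameDeriv σ g x := by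
  unfold frameDeriv
  rw [h.mfderiv_eq]
  rfl

/-- The differential applied to a linear combination of vectors, everything read in the model
space `ℝⁿ` (Mathlib's identification `T_x M = ℝⁿ`; the differential is recast as a continuous
linear map `ℝⁿ →L[ℝ] ℝⁿ` so that the two sides live in `ℝⁿ`). [folklore] -/
theorem mfderiv_apply_sum_smul (f : M → 𝔼 n) (x : M) (c : Fin n → ℝ) (v : Fin n → 𝔼 n) :
    (mfderiv (𝓡 n) (𝓡 n) f x (∑ k, c k • v k) : 𝔼 n) =
      ∑ k, c k • (mfderiv (𝓡 n) (𝓡 n) f x (v k) : 𝔼 n) := by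
  set L : 𝔼 n →L[ℝ] 𝔼 n := mfderiv (𝓡 n) (𝓡 n) f x with hL
  show L (∑ k, c k • v k) = ∑ k, c k • L (v k)
  rw [map_sum]
  simp_rw [map_smul]

section Chart

variable [IsManifold (𝓡 n) 1 M] {σ : Fin n → M → 𝔼 n}

/-- **The frame read in a chart is continuous.** For continuous vector fields `σᵢ`, the frame
derivative of the extended chart `φ = extChartAt x₀`, `z ↦ (d φ_z (σᵢ z))ᵢ` — `σ` read in the
trivialisation of `TM` over the chart domain (the tree's
`Literature.Topology.FourManifolds.trivializationAt_tangentSpace_snd`) — is continuous on the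
chart domain. [cite: HirschDT1976, Ch. 4 §2] -/
theorem continuousOn_frameDeriv_extChartAt
    (hσ : ∀ i, Continuous fun x => (⟨x, σ i x⟩ : TangentBundle (𝓡 n) M)) (x₀ : M) :
    ContinuousOn (frameDeriv σ (extChartAt (𝓡 n) x₀)) (chartAt (𝔼 n) x₀).source := by
  refine continuousOn_pi.2 fun i => ?_
  set e := trivializationAt (𝔼 n) (TangentSpace (𝓡 n) (M := M)) x₀ with he
  have h1 : ContinuousOn (fun z : M => (e ⟨z, σ i z⟩).2) (chartAt (𝔼 n) x₀).source := by
    have h2 : ContinuousOn (fun z : M => e ⟨z, σ i z⟩) (chartAt (𝔼 n) x₀).source := by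
      refine e.continuousOn.comp (hσ i).continuousOn fun z hz => ?_
      rw [e.mem_source, he, TangentBundle.trivializationAt_baseSet]
      exact hz
    exact continuous_snd.comp_continuousOn h2
  refine h1.congr fun z hz => ?_
  beta_reduce
  rw [he, trivializationAt_tangentSpace_snd hz]
  rfl

/-- **The frame read in a chart is a frame**: the differential of an extended chart is
invertible on the chart domain (`isInvertible_mfderiv_extChartAt`), so it maps the linearly
independent family `σ(z)` to a linearly independent family of `ℝⁿ`. [cite: HirschDT1976, Ch. 4 §2] -/
theorem linearIndependent_frameDeriv_extChartAt (hli : ∀ x, LinearIndependent ℝ fun i => σ i x)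
    {x₀ z : M} (hz : z ∈ (chartAt (𝔼 n) x₀).source) :
    LinearIndependent ℝ (frameDeriv σ (extChartAt (𝓡 n) x₀) z) := by
  have hz' : z ∈ (extChartAt (𝓡 n) x₀).source := by rwa [extChartAt_source]
  obtain ⟨L, hL⟩ := isInvertible_mfderiv_extChartAt (I := 𝓡 n) hz'
  have key : LinearIndependent ℝ (L.toLinearEquiv ∘ fun i => σ i z) :=
    (hli z).map' L.toLinearEquiv.toLinearMap L.toLinearEquiv.ker
  have key' : LinearIndependent ℝ fun i =>
      (L : TangentSpace (𝓡 n) z →L[ℝ] TangentSpace (𝓡 n) (extChartAt (𝓡 n) x₀ z)) (σ i z) :=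
    key
  rw [hL] at key'
  exact key'

end Chart

/-! ### Frame coordinates -/

/-- The basis `σ(x) = (σᵢ x)ᵢ` of `T_x M = ℝⁿ` given by a frame (`n` vectors, linearly
independent, `n = dim`). [cite: HirschDT1976, Ch. 4 §2] -/
def frameBasis (σ : Fin n → M → 𝔼 n) (hli : ∀ x, LinearIndependent ℝ fun i => σ i x) (x : M) :
    Basis (Fin n) ℝ (𝔼 n) :=
  basisOfLinearIndependentOfCardEqFinrank' (fun i => σ i x) (hli x)
    ((Fintype.card_fin n).trans finrank_euclideanSpace_fin.symm)

omit [TopologicalSpace M] [ChartedSpace (𝔼 n) M] in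
/-- The vectors of `frameBasis σ hli x` are the `σᵢ x`. [cite: HirschDT1976, Ch. 4 §2] -/
@[simp]
theorem coe_frameBasis (σ : Fin n → M → 𝔼 n) (hli : ∀ x, LinearIndependent ℝ fun i => σ i x)
    (x : M) : ⇑(frameBasis σ hli x) = fun i => σ i x :=
  coe_basisOfLinearIndependentOfCardEqFinrank' _ _ _

/-- The **coordinates** of a tangent vector `v ∈ T_x M = ℝⁿ` in the frame `σ(x)`.
[cite: HirschDT1976, Ch. 4 §2] -/
def frameCoord (σ : Fin n → M → 𝔼 n) (hli : ∀ x, LinearIndependent ℝ fun i => σ i x) (x : M)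
    (v : 𝔼 n) : Fin n → ℝ :=
  (frameBasis σ hli x).equivFun v

omit [TopologicalSpace M] [ChartedSpace (𝔼 n) M] in
/-- Reconstruction of a vector from its frame coordinates: `v = ∑ₖ (frameCoord σ x v)ₖ • σₖ x`.
[cite: HirschDT1976, Ch. 4 §2] -/
theorem sum_frameCoord_smul (σ : Fin n → M → 𝔼 n) (hli : ∀ x, LinearIndependent ℝ fun i => σ i x)
    (x : M) (v : 𝔼 n) : ∑ k, frameCoord σ hli x v k • σ k x = v := by
  have h := (frameBasis σ hli x).sum_equivFun v
  simp only [coe_frameBasis] at h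
  exact h

omit [TopologicalSpace M] [ChartedSpace (𝔼 n) M] in
/-- Frame coordinates are the unique coefficients: if `∑ₖ cₖ • σₖ x = v` then
`frameCoord σ x v = c`. [folklore] -/
theorem frameCoord_eq_of_sum_eq (σ : Fin n → M → 𝔼 n)
    (hli : ∀ x, LinearIndependent ℝ fun i => σ i x) (x : M) {v : 𝔼 n} {c : Fin n → ℝ}
    (h : ∑ k, c k • σ k x = v) : frameCoord σ hli x v = c := by
  have h' : (frameBasis σ hli x).equivFun.symm c = v := by
    rw [Basis.equivFun_symm_apply, coe_frameBasis]
    exact h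
  rw [frameCoord, ← h', LinearEquiv.apply_symm_apply]

omit [TopologicalSpace M] [ChartedSpace (𝔼 n) M] in
/-- The frame vector `σᵢ x` has coordinates `eᵢ = Pi.single i 1`. [folklore] -/
theorem frameCoord_frame (σ : Fin n → M → 𝔼 n) (hli : ∀ x, LinearIndependent ℝ fun i => σ i x)
    (x : M) (i : Fin n) : frameCoord σ hli x (σ i x) = Pi.single i 1 := by
  refine frameCoord_eq_of_sum_eq σ hli x ?_
  simp [Pi.single_apply]

omit [TopologicalSpace M] [ChartedSpace (𝔼 n) M] in
/-- Frame coordinates are additive in the vector. [folklore] -/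
theorem frameCoord_add (σ : Fin n → M → 𝔼 n) (hli : ∀ x, LinearIndependent ℝ fun i => σ i x)
    (x : M) (v w : 𝔼 n) :
    frameCoord σ hli x (v + w) = frameCoord σ hli x v + frameCoord σ hli x w :=
  map_add _ v w

omit [TopologicalSpace M] [ChartedSpace (𝔼 n) M] in
/-- Frame coordinates are homogeneous in the vector. [folklore] -/
theorem frameCoord_smul (σ : Fin n → M → 𝔼 n) (hli : ∀ x, LinearIndependent ℝ fun i => σ i x)
    (x : M) (a : ℝ) (v : 𝔼 n) : frameCoord σ hli x (a • v) = a • frameCoord σ hli x v :=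
  map_smul _ a v

/-! ### Continuity of frame coordinates -/

section Continuity

variable [IsManifold (𝓡 n) 1 M] {σ : Fin n → M → 𝔼 n}

/-- The linear map `u ↦ ∑ₖ uₖ • Sₖ` attached to a family `S` of `n` vectors of `ℝⁿ`, as a
continuous linear map (a sum of rank-one operators). Auxiliary. [folklore] -/
theorem sum_smulRight_apply (S : Fin n → 𝔼 n) (u : Fin n → ℝ) :
    (∑ k, (ContinuousLinearMap.proj k : (Fin n → ℝ) →L[ℝ] ℝ).smulRight (S k)) u =
      ∑ k, u k • S k := by
  simp only [FunLike.coe_sum, Finset.sum_apply, ContinuousLinearMap.smulRight_apply,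
    ContinuousLinearMap.proj_apply]

/-- If `S` is a linearly independent family of `n` vectors of `ℝⁿ`, the map `u ↦ ∑ₖ uₖ • Sₖ` is a
continuous linear isomorphism `ℝⁿ → ℝⁿ` (injective by independence, onto by dimension).
Auxiliary. [folklore] -/
theorem exists_equiv_eq_sum_smulRight {S : Fin n → 𝔼 n} (hS : LinearIndependent ℝ S) :
    ∃ e : (Fin n → ℝ) ≃L[ℝ] 𝔼 n, (e : (Fin n → ℝ) →L[ℝ] 𝔼 n) =
      ∑ k, (ContinuousLinearMap.proj k : (Fin n → ℝ) →L[ℝ] ℝ).smulRight (S k) := by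
  set A : (Fin n → ℝ) →L[ℝ] 𝔼 n :=
    ∑ k, (ContinuousLinearMap.proj k : (Fin n → ℝ) →L[ℝ] ℝ).smulRight (S k) with hA
  have hinj : Injective (A : (Fin n → ℝ) →ₗ[ℝ] 𝔼 n) := by
    rw [← LinearMap.ker_eq_bot, LinearMap.ker_eq_bot']
    intro u hu
    have hu' : ∑ k, u k • S k = 0 := by
      rw [← sum_smulRight_apply S u]
      exact hu
    funext i
    exact Fintype.linearIndependent_iff.1 hS u hu' i
  have hdim : finrank ℝ (Fin n → ℝ) = finrank ℝ (𝔼 n) := by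
    rw [Module.finrank_fin_fun, finrank_euclideanSpace_fin]
  refine ⟨(LinearMap.linearEquivOfInjective (A : (Fin n → ℝ) →ₗ[ℝ] 𝔼 n) hinj
    hdim).toContinuousLinearEquiv, ?_⟩
  ext u
  rfl

/-- **Frame coordinates are continuous on the tangent bundle.** Let `σ` be a continuous frame
of the `C¹` manifold `M` and `p ↦ w p ∈ T_{y p} M` a continuous family of tangent vectors
(continuous as a map into `TangentBundle`, `p` in any topological space). Then the coordinate
functions `p ↦ frameCoord σ (y p) (w p) ∈ ℝⁿ` are continuous. Read through the differential of
the chart `φ` at `y p₀` (the trivialisation of `TM` there), the frame becomes the continuous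
family of bases `S(z) = (d φ_z (σₖ z))ₖ` of `ℝⁿ` (`continuousOn_frameDeriv_extChartAt`,
`linearIndependent_frameDeriv_extChartAt`), the family becomes the continuous map
`W p = d φ (w p)`, and the coordinates are `A(y p)⁻¹ (W p)` with `A(z) u = ∑ uₖ Sₖ(z)` a
continuous family of isomorphisms; inversion is continuous at invertible maps
(`contDiffAt_map_inverse`). [cite: HirschDT1976, Ch. 4 §2] -/
theorem continuous_frameCoord (hσ : ∀ i, Continuous fun x => (⟨x, σ i x⟩ : TangentBundle (𝓡 n) M))
    (hli : ∀ x, LinearIndependent ℝ fun i => σ i x) {P : Type*} [TopologicalSpace P]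
    {y : P → M} {w : P → 𝔼 n}
    (hw : Continuous fun p => (⟨y p, w p⟩ : TangentBundle (𝓡 n) M)) :
    Continuous fun p => frameCoord σ hli (y p) (w p) := by
  have hy : Continuous y := (FiberBundle.continuous_proj (𝔼 n) (TangentSpace (𝓡 n))).comp hw
  refine continuous_iff_continuousAt.2 fun p₀ => ?_
  -- the chart at `y p₀`, its domain `C`, the frame read in it `S`, the isomorphisms `A`
  set x₀ : M := y p₀ with hx₀
  set C : Set M := (chartAt (𝔼 n) x₀).source with hC
  have hC_open : IsOpen C := (chartAt (𝔼 n) x₀).open_source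
  have hx₀C : x₀ ∈ C := mem_chart_source (𝔼 n) x₀
  set S : M → Fin n → 𝔼 n := frameDeriv σ (extChartAt (𝓡 n) x₀) with hS
  set A : M → (Fin n → ℝ) →L[ℝ] 𝔼 n := fun z =>
    ∑ k, (ContinuousLinearMap.proj k : (Fin n → ℝ) →L[ℝ] ℝ).smulRight (S z k) with hA
  have hA_cont : ContinuousOn A C := by
    have hSc := continuousOn_frameDeriv_extChartAt hσ x₀
    refine continuousOn_finsetSum _ fun k _ => ?_
    exact (ContinuousLinearMap.smulRightL ℝ (Fin n → ℝ) (𝔼 n)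
      (ContinuousLinearMap.proj k)).continuous.comp_continuousOn ((continuousOn_pi.1 hSc) k)
  -- `A (y p₀)` is invertible, so inversion is continuous there
  obtain ⟨e₀, he₀⟩ := exists_equiv_eq_sum_smulRight
    (linearIndependent_frameDeriv_extChartAt hli (x₀ := x₀) hx₀C)
  have hAinv : ContinuousAt (fun p => (A (y p)).inverse) p₀ := by
    have h1 : ContinuousAt ContinuousLinearMap.inverse (A (y p₀)) := by
      have : A (y p₀) = (e₀ : (Fin n → ℝ) →L[ℝ] 𝔼 n) := he₀.symm
      rw [this]
      exact (contDiffAt_map_inverse (n := 0) e₀).continuousAt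
    have h3 : ContinuousAt (A ∘ y) p₀ :=
      (hA_cont.continuousAt (hC_open.mem_nhds hx₀C)).comp hy.continuousAt
    exact ContinuousAt.comp (f := A ∘ y) h1 h3
  -- the family read in the chart: `W p = d φ (w p)`
  set eT := trivializationAt (𝔼 n) (TangentSpace (𝓡 n) (M := M)) x₀ with heT
  have hW : ContinuousAt (fun p => (eT ⟨y p, w p⟩).2) p₀ := by
    have h2 : ContinuousAt (fun p => eT ⟨y p, w p⟩) p₀ := by
      refine (eT.continuousOn.continuousAt (eT.open_source.mem_nhds ?_)).comp hw.continuousAt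
      rw [eT.mem_source, heT, TangentBundle.trivializationAt_baseSet]
      exact hx₀C
    exact continuousAt_snd.comp h2
  -- the identity `frameCoord = A⁻¹ W` near `p₀`
  have key : ∀ p, y p ∈ C →
      frameCoord σ hli (y p) (w p) = (A (y p)).inverse (eT ⟨y p, w p⟩).2 := by
    intro p hp
    set c := frameCoord σ hli (y p) (w p) with hc
    have hsum : ∑ k, c k • σ k (y p) = w p := sum_frameCoord_smul σ hli (y p) (w p)
    -- `A (y p) c = d φ (∑ cₖ σₖ) = d φ (w p) = W p`
    have hAc : A (y p) c = (eT ⟨y p, w p⟩).2 := by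
      rw [heT, trivializationAt_tangentSpace_snd hp (w p)]
      have h4 : A (y p) c = ∑ k, c k • S (y p) k := sum_smulRight_apply (S (y p)) c
      rw [h4, ← hsum]
      exact (mfderiv_apply_sum_smul (extChartAt (𝓡 n) x₀) (y p) c fun k => σ k (y p)).symm
    obtain ⟨e, he⟩ := exists_equiv_eq_sum_smulRight
      (linearIndependent_frameDeriv_extChartAt hli (x₀ := x₀) hp)
    have hAe : A (y p) = (e : (Fin n → ℝ) →L[ℝ] 𝔼 n) := he.symm
    rw [← hAc, hAe, ContinuousLinearMap.inverse_equiv]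
    exact (e.symm_apply_apply c).symm
  -- conclude
  have hev : (fun p => (A (y p)).inverse (eT ⟨y p, w p⟩).2) =ᶠ[𝓝 p₀]
      fun p => frameCoord σ hli (y p) (w p) := by
    filter_upwards [hy.continuousAt.preimage_mem_nhds (hC_open.mem_nhds hx₀C)] with p hp
    exact (key p hp).symm
  exact (hAinv.clm_apply hW).congr hev

/-- **The bundle map of a formal derivative is continuous along continuous families.** For a
continuous frame `σ`, a continuous field `Ψ : M → (ℝⁿ)ⁿ` and a continuous family of tangent
vectors `p ↦ w p ∈ T_{y p} M`, the vectors `∑ₖ (frameCoord σ (y p) (w p))ₖ • Ψ (y p) k ∈ ℝⁿ`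
— the images of `w p` under the fibrewise linear maps `T_x M → ℝⁿ`, `σₖ x ↦ Ψ x k` — depend
continuously on `p`. [folklore] -/
theorem continuous_frameCoord_smul_sum
    (hσ : ∀ i, Continuous fun x => (⟨x, σ i x⟩ : TangentBundle (𝓡 n) M))
    (hli : ∀ x, LinearIndependent ℝ fun i => σ i x) {Ψ : M → Fin n → 𝔼 n} (hΨ : Continuous Ψ)
    {P : Type*} [TopologicalSpace P] {y : P → M} {w : P → 𝔼 n}
    (hw : Continuous fun p => (⟨y p, w p⟩ : TangentBundle (𝓡 n) M)) :
    Continuous fun p => ∑ k, frameCoord σ hli (y p) (w p) k • Ψ (y p) k := by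
  have hy : Continuous y := (FiberBundle.continuous_proj (𝔼 n) (TangentSpace (𝓡 n))).comp hw
  have hc := continuous_frameCoord hσ hli hw
  refine continuous_finsetSum _ fun k _ => ?_
  exact ((continuous_apply k).comp hc).smul ((continuous_apply k).comp (hΨ.comp hy))

end Continuity

end Literature.Topology.Immersions
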